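import Summits.QuantumAdvantage.QuantumAdvantage.Theorems.MobiusLadderLiouvilleNotAC0Xor

/-!
# The crux `DigitPolyUniformity` implies weak top-block inapproximability

Calibration stub W2 of line Sketch/LAR of crux stmt-QuantumAdvantage-1392
(`Summit.QuantumAdvantage.QuantumAdvantage.Theses.MobiusLadder.DigitPolyUniformity`). The `AC⁰[⊕]`
rung of the Möbius ladder needs only ONE-SIDED CONSTANT-SLACK inapproximability of `λ` by
polylogarithmic-degree `𝔽₂`-polynomials on the top dyadic block `[2^{n−1}, 2ⁿ)` (stub W1,
`liouvilleNotAC0Xor_of_inapprox`). This file shows that the crux implies that weak form for every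
`c < 1/2`:

  `DigitPolyUniformity → ∀ c < 1/2, ∀ A, ∀ᶠ n, ∀ P, deg P ≤ (log₂ n)^A →
      Σ_{2^{n−1} ≤ N < 2ⁿ} λ(N) χ_P(N) ≤ (1/2 − c) 2ⁿ`.

Proof: with `ε = 1/2 − c > 0` and `n ≥ 2` in the crux's eventual set for `(A, ε)`, compare the crux's
sums over `N < 2ⁿ` for `P` and for `Q = P + x_{n−1}` (still of degree `≤ max(deg P, 1) ≤ (log₂ n)^A`):
`χ_Q(N) = χ_P(N)·(−1)^{bit_{n−1} N}`, so half their difference is the sum over the top block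
`T = {N < 2ⁿ : bit_{n−1} N = 1} = [2^{n−1}, 2ⁿ)`, whence `|Σ_T λ χ_P| ≤ ε 2ⁿ`
(`abs_sum_le_of_twist`), and a fortiori the one-sided bound.
-/

namespace Summit.QuantumAdvantage.DigitPolyUniformity.SketchLAR

open Filter Finset
open Summit.QuantumAdvantage.QuantumAdvantage.Theses.MobiusLadder (DigitPolyUniformity)
open Summit.QuantumAdvantage.QuantumAdvantage.Theorems.MobiusLadder (abs_sum_le_of_twist sign_add_bit)

/-- **The top dyadic block as a bit condition.** For `n ≥ 1`, the numbers `N < 2ⁿ` whose bit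
`n − 1` is set are exactly the block `[2^{n−1}, 2ⁿ)`. [folklore] -/
theorem filter_testBit_eq_Ico {n : ℕ} (hn : 1 ≤ n) :
    (range (2 ^ n)).filter (fun N => Nat.testBit N (n - 1) = true) = Ico (2 ^ (n - 1)) (2 ^ n) := by
  ext N
  rw [mem_filter, mem_range, mem_Ico]
  constructor
  · rintro ⟨hlt, hbit⟩
    exact ⟨Nat.ge_two_pow_of_testBit hbit, hlt⟩
  · rintro ⟨hge, hlt⟩
    refine ⟨hlt, Nat.testBit_of_two_pow_le_and_two_pow_add_one_gt hge ?_⟩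
    rw [Nat.sub_add_cancel hn]
    exact hlt

/-- **Stub W2: the crux implies the weak hypothesis of W1 for every `c < 1/2`.** Comparing the crux's
sums for `P` and `P + x_{n−1}` isolates the top block (`abs_sum_le_of_twist` of
`Theorems/MobiusLadderLiouvilleNotAC0Xor.lean`): `|Σ_{2^{n−1} ≤ N < 2ⁿ} λ χ_P| ≤ ε 2ⁿ` with `ε = 1/2 − c`
(degree of `P + x_{n−1}` is `≤ max(deg P, 1) ≤ (log₂ n)^A` once `n ≥ 2`). [folklore] -/
theorem inapprox_of_digitPolyUniformity (hU : DigitPolyUniformity) :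
    ∀ c : ℝ, c < 1 / 2 → ∀ A : ℕ, ∀ᶠ n : ℕ in atTop, ∀ P : MvPolynomial (Fin n) (ZMod 2),
      P.totalDegree ≤ Nat.log 2 n ^ A →
        ∑ N ∈ Finset.Ico (2 ^ (n - 1)) (2 ^ n), ((ArithmeticFunction.liouville N : ℤ) : ℝ) *
            (if MvPolynomial.eval (fun i : Fin n => if Nat.testBit N i then (1 : ZMod 2) else 0) P = 1
              then (-1 : ℝ) else 1) ≤ (1 / 2 - c) * (2 : ℝ) ^ n := by
  intro c hc A
  have hε : (0 : ℝ) < 1 / 2 - c := by linarith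
  filter_upwards [hU A (1 / 2 - c) hε, eventually_ge_atTop 2] with n hn1 hn2
  intro P hPdeg
  have hlog1 : 1 ≤ Nat.log 2 n := Nat.log_pos one_lt_two hn2
  have hDg1 : 1 ≤ Nat.log 2 n ^ A := Nat.one_le_pow _ _ hlog1
  have hn1n : n - 1 < n := by omega
  -- the twisted test polynomial `Q = P + x_{n-1}`
  obtain ⟨Q, hQdef⟩ : ∃ Q : MvPolynomial (Fin n) (ZMod 2), Q = P + MvPolynomial.X ⟨n - 1, hn1n⟩ :=
    ⟨_, rfl⟩
  have hQdeg : Q.totalDegree ≤ Nat.log 2 n ^ A := by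
    rw [hQdef]
    refine (MvPolynomial.totalDegree_add _ _).trans (max_le hPdeg ?_)
    rw [MvPolynomial.totalDegree_X]
    exact hDg1
  have hSP := hn1 P hPdeg
  have hSQ := hn1 Q hQdeg
  -- the top block `T` inside `R = [0, 2ⁿ)`
  set R : Finset ℕ := Finset.range (2 ^ n) with hR
  set T : Finset ℕ := R.filter (fun N => Nat.testBit N (n - 1) = true) with hT
  have hTR : T ⊆ R := Finset.filter_subset _ _
  have hmemT : ∀ {N : ℕ}, N ∈ T ↔ N < 2 ^ n ∧ Nat.testBit N (n - 1) = true := fun {N} => by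
    simp [hT, hR]
  have hTeq : T = Finset.Ico (2 ^ (n - 1)) (2 ^ n) := by
    rw [hT, hR]
    exact filter_testBit_eq_Ico (by omega)
  -- the crux's sum for `Q` is the `P`-sum twisted by the sign of bit `n - 1`
  have hSQ' : |∑ N ∈ R, ((ArithmeticFunction.liouville N : ℤ) : ℝ) *
        (if MvPolynomial.eval (fun i : Fin n => if Nat.testBit N i then (1 : ZMod 2) else 0) P = 1
          then (-1 : ℝ) else 1) *
        (if Nat.testBit N (n - 1) = true then (-1 : ℝ) else 1)| ≤ (1 / 2 - c) * (2 : ℝ) ^ n := by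
    refine le_of_eq_of_le (congrArg _ (Finset.sum_congr rfl fun N _ => ?_)) hSQ
    rw [hQdef, map_add, MvPolynomial.eval_X, mul_assoc, ← sign_add_bit]
  -- isolate the top block
  have hup := abs_sum_le_of_twist hTR
    (t := fun N => if Nat.testBit N (n - 1) = true then (-1 : ℝ) else 1)
    (fun N hN => if_pos (hmemT.1 hN).2)
    (fun N hNR hNT => if_neg fun h => hNT (hmemT.2 ⟨by simpa [hR] using hNR, h⟩)) hSP hSQ'
  rw [← hTeq]
  exact (le_abs_self _).trans hup

end Summit.QuantumAdvantage.DigitPolyUniformity.SketchLAR
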